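import Summits.Ventures.HSemireg.ObstructionLocusBlockBranches
import Summits.Ventures.HSemireg.ObstructionLocusBlockFields

/-!
# Venture HSemireg — (S5) OBSTRUCTION LOCUS away from secant type, XIX: the BLOCK MODELS `M(S_1, …, S_r)` —
# **`Hom_R(I_M, R/I_M) ≅ ⊕_{blocks i} ⊕_{a ≠ b ∈ S_i} R/(x_b, x_a)`** (EXT-NOTE §6.B(a), every block model, every `n`,
# every commutative coefficient ring)

HONEST FRAMING.  Companion of `ObstructionLocusBlockIdeal/Arrangement/Branches/Fields.lean` (cell `pub-hsemireg`, track
«S4-PUSH» (ii), seat s4-prove-2; vocabulary and honest framing as there).  This file assembles the MULTI-BLOCK LOCAL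
LEMMA: for every block structure `B` (pairwise disjoint non-empty `S_i ⊂ [n]`) the normal module of the arrangement
ideal `I_M = ⋂_i (x_{S_i ∖ a} : a ∈ S_i)` of `M(S_1, …, S_r) = ⋃_i K_{S_i} × 𝔸` is, `R`-linearly,
`Hom_R(I_M, R/I_M) ≅ Π_{(i, a, b) : a ∈ S_i, b ∈ S_i ∖ a} R/(x_b, x_a)` — two copies of `𝒪(V(x_a, x_b) × 𝔸)` per
component, «no poles, no gluing» — general-structure/EXT-NOTE.md §6.B(a) («`𝓝′ = 𝓗om(I_Z, 𝒪_Z) = ⊕_B ν_{B*} N_{B/X}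
≅ ⊕_B ν_{B*} 𝒪_B^{⊕2}`, every block model, hence every point of every `Z_T` under (GEN)»; on paper: generators and
block syzygies from the tensor product of the Hilbert–Burch resolutions 6.A, then the pole-shape / peeling argument
(i)–(v) — Künneth enters only 6.B(b)(c); machine check: 3438 multidegrees over nine block types, 0 mismatches;
source-author read of these drafts, deform-ring2 g214: faithful, 0 findings).  What this does for (S5): the LOCAL-ALGEBRA input of the named hypothesis shape (H-arr)
of file I (`ReduciblePointObject.HArr`) is now a kernel theorem at EVERY point of a (GEN) arrangement — the crossing
germs of `m ≥ 2` translates included (files VIII–X: single-translate germs only; deform-ring2 g210 remark r1 named the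
multi-block step as the remaining local dictionary item).  STILL PROSE / BINDER, unchanged: the étale-local passage
from `(X, Z_T)_q` to `(𝔸ⁿ, M)_0` and sheafification (EXT-NOTE §6.0), Prop. K + the Čech line, completion, (R4), the
`Ext¹`/long-exact-sequence reading §6.B(b)(c), and all of (H-NC).  Nothing here constructs a variety or a sheaf;
nothing here says that HC / HC_CM / HC_AV holds; no Literature fact is declared or used; no object is certified.

METHOD (no presentation of `I_M` is used).  `ρ` sends `φ : I_M → R/I_M` to its BRANCH COORDINATES: project to
`R/I_{S_i}`, evaluate at the test element `gen i a = x_{S_i ∖ a} x_{rest i}`, expand in the `V`-scaled branch map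
(file XVII, «no poles») and read the coefficient of `x_{S_i ∖ {a,b}} x_{rest i}` modulo `(x_b, x_a)`.  `τ` sends a
branch function `(f_t)` to the sum of the explicit branch fields `σ_t(f_t)` (file XVIII, «no gluing»).  `ρ ∘ τ = id`
by the values of `T_{a,b}` on the test elements; `ρ` is injective because a `φ` with all branch coordinates zero
kills every `gen i a` in every `R/I_{S_i}`, hence vanishes in every `R/I_{S_i}` (file XVII), hence in `R/I_M`
(`I_M = ⋂_i I_{S_i}`).

* `Branch B` (triples `(i, a, b)`, `a ∈ S_i`, `b ∈ S_i ∖ a`), `BranchFunctions K B = Π_t R/(x_b, x_a)`,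
  `card_branch` (`#Branch = Σ_i |S_i|(|S_i| − 1) = 2 · #components`).
* `toBlock`, `eq_zero_of_forall_factor_eq_zero` (`R/I_M ↪ Π_i R/I_{S_i}`); `finitePresentation_arrIdeal`,
  `isLocalizedModule_blockNormalModule` (the computation localises: Mathlib's base change of `Hom` out of a finitely
  presented module, `K` Noetherian).
* `rho`, `tau`, `rho_sigma` (`ρ(σ_t q) = δ_t q`), **`rho_tau`** (`ρ ∘ τ = id`), **`rho_injective`**.
* **`blockNormalModuleEquiv B : Hom_R(I_M, R/I_M) ≃ₗ[R] BranchFunctions K B`** — THE MULTI-BLOCK LOCAL LEMMA;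
  `blockNormalModuleEquiv_symm_apply` (the inverse is `τ`: every normal field is the sum of its branch fields),
  `tau_rho`, `tau_single` / `blockNormalModuleEquiv_symm_single` (a unit vector of branch functions is a branch field).
* `NestedBranchFunctions`, `branchFunctionsCurry`, **`blockNormalModuleEquivNested`** — the same lemma in the nested
  indexing `Π_i Π_{a ∈ S_i} Π_{b ∈ S_i ∖ a} R/(x_b, x_a)` of files VIII/IX, `blockNormalModuleEquivNested_apply`.
* One block: `Blocks.single`, `arrIdeal_single` (`= blockIdeal K S`; with `blockIdeal_univ` of file XV the case
  `S = [n]` is file VIII's `I_W`, so files VIII/IX's `normalModuleEquiv` is recovered up to the indexing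
  `(k, j) ↔ (·, k, j)` — now WITHOUT the domain hypothesis on `K`).
References (dictionary only): EXT-NOTE.md §6.0, §6.A, §6.B(a); G2-REDUCIBLE-POINT-THEOREM.md §2 L1; STRUCTURE.md §2
(S5)/(S-B), hypothesis (H-arr).
-/

open scoped BigOperators
open MvPolynomial Finset

namespace Summit.Ventures.HSemireg.ObstructionLocus.BlockModel

variable {K : Type*} [CommRing K] {n : ℕ} {ι : Type*}

/-! ## Branch data and branch functions -/

/-- BRANCH DATA of the block model: triples `t = (i, a, b)` with `a ∈ S_i`, `b ∈ S_i ∖ a` — the component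
`V(x_a, x_b) × 𝔸` of `M` through block `i`, seen on the generator `x_{S_i ∖ a}`; each component `{a, b}` occurs twice,
as `(i, a, b)` and `(i, b, a)` («`A_B²`»). -/
abbrev Branch (B : Blocks ι n) : Type _ :=
  {t : ι × Fin n × Fin n // t.2.1 ∈ B.S t.1 ∧ t.2.2 ∈ (B.S t.1).erase t.2.1}

variable (K) in
/-- BRANCH FUNCTIONS: a class in `R/(x_b, x_a) = 𝒪(V(x_a, x_b) × 𝔸)` for every branch datum `(i, a, b)`. -/
abbrev BranchFunctions (B : Blocks ι n) : Type _ :=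
  (t : Branch B) → MvPolynomial (Fin n) K ⧸ Ideal.span {(X t.1.2.2 : MvPolynomial (Fin n) K), X t.1.2.1}

/-! ## `R/I_M ↪ Π_i R/I_{S_i}` -/

/-- Post-composition with `R/I_M → R/I_{S_i}`. -/
noncomputable def toBlock (B : Blocks ι n) (i : ι) :
    (↥(arrIdeal K B) →ₗ[MvPolynomial (Fin n) K] MvPolynomial (Fin n) K ⧸ arrIdeal K B)
      →ₗ[MvPolynomial (Fin n) K]
        (↥(arrIdeal K B) →ₗ[MvPolynomial (Fin n) K] MvPolynomial (Fin n) K ⧸ blockIdeal K (B.S i)) :=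
  LinearMap.llcomp (MvPolynomial (Fin n) K) _ _ _ (Submodule.factor (arrIdeal_le B i))

/-- Its values. -/
theorem toBlock_apply (B : Blocks ι n) (i : ι)
    (ψ : ↥(arrIdeal K B) →ₗ[MvPolynomial (Fin n) K] MvPolynomial (Fin n) K ⧸ arrIdeal K B) (u : ↥(arrIdeal K B)) :
    toBlock B i ψ u = Submodule.factor (arrIdeal_le B i) (ψ u) := rfl

/-- `R/I_M → R/I_{S_i}` on representatives. -/
theorem factor_mk (B : Blocks ι n) (i : ι) (g : MvPolynomial (Fin n) K) :
    Submodule.factor (arrIdeal_le B i) (Ideal.Quotient.mk (arrIdeal K B) g)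
      = Ideal.Quotient.mk (blockIdeal K (B.S i)) g := rfl

/-- **`R/I_M ↪ Π_i R/I_{S_i}`** (`I_M = ⋂_i I_{S_i}`). -/
theorem eq_zero_of_forall_factor_eq_zero (B : Blocks ι n) {y : MvPolynomial (Fin n) K ⧸ arrIdeal K B}
    (h : ∀ i, Submodule.factor (arrIdeal_le B i) y = 0) : y = 0 := by
  obtain ⟨g, rfl⟩ := Ideal.Quotient.mk_surjective y
  rw [Ideal.Quotient.eq_zero_iff_mem, mem_arrIdeal_iff]
  intro i
  rw [← Ideal.Quotient.eq_zero_iff_mem]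
  exact h i

/-! ## Localisation -/

/-- `I_M` is a finitely presented `R`-module (`R = K[x_1, …, x_n]` is Noetherian for Noetherian `K`). -/
instance finitePresentation_arrIdeal [IsNoetherianRing K] (B : Blocks ι n) :
    Module.FinitePresentation (MvPolynomial (Fin n) K) ↥(arrIdeal K B) :=
  Module.finitePresentation_of_finite _ _

/-- **The multi-block lemma LOCALISES** (as file X's `isLocalizedModule_normalModule` for one block): for every
multiplicative set `S ⊆ R` and all localisation maps `f : I_M → (I_M)_S`, `g : R/I_M → (R/I_M)_S`, the induced map
`Hom_R(I_M, R/I_M) → Hom_R((I_M)_S, (R/I_M)_S)` IS a localisation at `S` (Mathlib's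
`Module.FinitePresentation.isLocalizedModule_map`, `K` Noetherian); so `blockNormalModuleEquiv` computes the normal
module of `M` at every prime of `R` — every point of the block model (EXT-NOTE §6.0: «statements about `(R, I)` are
statements about the stalks»; the étale chart `(X, Z_T)_q ≅ (𝔸ⁿ, M)_0` itself and completion stay prose). -/
theorem isLocalizedModule_blockNormalModule [IsNoetherianRing K] (B : Blocks ι n)
    (S : Submonoid (MvPolynomial (Fin n) K))
    {IS : Type*} [AddCommGroup IS] [Module (MvPolynomial (Fin n) K) IS]
    (f : ↥(arrIdeal K B) →ₗ[MvPolynomial (Fin n) K] IS) [IsLocalizedModule S f]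
    {QS : Type*} [AddCommGroup QS] [Module (MvPolynomial (Fin n) K) QS]
    (g : (MvPolynomial (Fin n) K ⧸ arrIdeal K B) →ₗ[MvPolynomial (Fin n) K] QS) [IsLocalizedModule S g] :
    IsLocalizedModule S (IsLocalizedModule.map S f g) :=
  inferInstance

/-! ## The branch coordinates `ρ` and the branch fields `τ` -/

/-- Branch data as an iterated sigma type: a block, a generator index in it, a partner. -/
def branchEquivSigma (B : Blocks ι n) :
    Branch B ≃ Σ i : ι, Σ a : ↥(B.S i), ↥((B.S i).erase a.1) where
  toFun t := ⟨t.1.1, ⟨t.1.2.1, t.2.1⟩, ⟨t.1.2.2, t.2.2⟩⟩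
  invFun s := ⟨(s.1, s.2.1.1, s.2.2.1), s.2.1.2, s.2.2.2⟩
  left_inv _ := rfl
  right_inv _ := rfl

variable [Fintype ι]

/-- **The number of branch data is `Σ_i |S_i| (|S_i| − 1) = 2 · #{components}`** — two entries per component
`V(x_a, x_b) × 𝔸`, `{a, b} ⊂ S_i` (EXT-NOTE §6.B(a) / §6.C(1): `𝓝′` has rank `2` on each component; one block
`S = [n]`: `n(n − 1) = h(W)`; the machine-check column «`Σ_l dim Hom_{−e_l} = 2 · #components`»). -/
theorem card_branch (B : Blocks ι n) :
    Fintype.card (Branch B) = ∑ i, (B.S i).card * ((B.S i).card - 1) := by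
  classical
  rw [Fintype.card_congr (branchEquivSigma B), Fintype.card_sigma]
  refine Finset.sum_congr rfl fun i _ => ?_
  rw [Fintype.card_sigma]
  simp only [Fintype.card_coe]
  rw [Finset.sum_congr rfl fun (a : ↥(B.S i)) _ => Finset.card_erase_of_mem a.2, Finset.sum_const, Finset.card_univ,
    Fintype.card_coe, smul_eq_mul]

/-- **`τ : BranchFunctions →ₗ[R] Hom_R(I_M, R/I_M)`**: the sum of the branch fields `σ_t(f_t)` of file XVIII. -/
noncomputable def tau (B : Blocks ι n) :
    BranchFunctions K B
      →ₗ[MvPolynomial (Fin n) K]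
        (↥(arrIdeal K B) →ₗ[MvPolynomial (Fin n) K] MvPolynomial (Fin n) K ⧸ arrIdeal K B) :=
  ∑ t : Branch B, sigma B t.2.1 t.2.2 ∘ₗ LinearMap.proj t

/-- Its values. -/
theorem tau_apply (B : Blocks ι n) (v : BranchFunctions K B) :
    tau B v = ∑ t : Branch B, sigma B t.2.1 t.2.2 (v t) := by
  simp only [tau, LinearMap.sum_apply, LinearMap.comp_apply, LinearMap.proj_apply]

variable [DecidableEq ι]

/-- **`ρ : Hom_R(I_M, R/I_M) →ₗ[R] BranchFunctions`**: the branch coordinates of a normal field —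
component `(i, a, b)` = file XVII's `ρ_{i,a}` (after projecting to `R/I_{S_i}`), entry `b`; in EXT-NOTE's notation
this is `φ(x_b)|_B`, the `x_b`-entry of `ρ(φ)_B`, `B = V(x_a, x_b)`. -/
noncomputable def rho (B : Blocks ι n) :
    (↥(arrIdeal K B) →ₗ[MvPolynomial (Fin n) K] MvPolynomial (Fin n) K ⧸ arrIdeal K B)
      →ₗ[MvPolynomial (Fin n) K] BranchFunctions K B :=
  LinearMap.pi fun t : Branch B =>
    LinearMap.proj (⟨t.1.2.2, t.2.2⟩ : ↥((B.S t.1.1).erase t.1.2.1))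
      ∘ₗ rhoLoc B t.1.1 ⟨t.1.2.1, t.2.1⟩ ∘ₗ toBlock B t.1.1

/-- Its values. -/
theorem rho_apply (B : Blocks ι n)
    (ψ : ↥(arrIdeal K B) →ₗ[MvPolynomial (Fin n) K] MvPolynomial (Fin n) K ⧸ arrIdeal K B) (t : Branch B) :
    rho B ψ t = rhoLoc B t.1.1 ⟨t.1.2.1, t.2.1⟩ (toBlock B t.1.1 ψ) ⟨t.1.2.2, t.2.2⟩ := rfl

/-! ## `ρ ∘ τ = id`: the branch coordinates of a branch field -/

/-- If `T_{a,b}` kills the test element `gen j a'`, the branch coordinates of `σ_{i,a,b}(f)` at `(j, a')` vanish. -/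
theorem rhoLoc_toBlock_branchField_eq_zero (B : Blocks ι n) {i j : ι} {a b : Fin n} (ha : a ∈ B.S i)
    (hb : b ∈ (B.S i).erase a) (f : MvPolynomial (Fin n) K) (a' : ↥(B.S j))
    (h0 : dropDiv a b (gen B j a'.1 : MvPolynomial (Fin n) K) = 0) :
    rhoLoc B j a' (toBlock B j (branchField B ha hb f)) = 0 := by
  have key : toBlock B j (branchField B ha hb f) ⟨gen B j a'.1, gen_mem B a'.2⟩ = branchMapV B j a'.1 0 := by
    rw [map_zero, toBlock_apply, branchField_apply, h0, mul_zero, map_zero, map_zero]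
  rw [rhoLoc_apply_of_eq B a' key]
  funext b'
  rw [Pi.zero_apply, Pi.zero_apply, map_zero]

/-- At its own generator `(i, a)` the branch coordinates of `σ_{i,a,b}(f)` are `(δ_{b b'} f)_{b'}`. -/
theorem rhoLoc_toBlock_branchField_self (B : Blocks ι n) {i : ι} {a b : Fin n} (ha : a ∈ B.S i)
    (hb : b ∈ (B.S i).erase a) (f : MvPolynomial (Fin n) K) :
    rhoLoc B i ⟨a, ha⟩ (toBlock B i (branchField B ha hb f))
      = fun b' : ↥((B.S i).erase a) => Ideal.Quotient.mk (Ideal.span {(X b'.1 : MvPolynomial (Fin n) K), X a})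
          ((Pi.single (⟨b, hb⟩ : ↥((B.S i).erase a)) f : ↥((B.S i).erase a) → MvPolynomial (Fin n) K) b') := by
  apply rhoLoc_apply_of_eq
  rw [toBlock_apply, branchField_apply, dropDiv_gen_self B ha hb, factor_mk, branchMapV_apply]
  congr 1
  rw [Finset.sum_eq_single (⟨b, hb⟩ : ↥((B.S i).erase a))]
  · rw [Pi.single_eq_same]
  · intro b' _ hb'
    rw [Pi.single_eq_of_ne hb', zero_mul]
  · intro h
    exact absurd (mem_univ _) h

/-- **`ρ(σ_t(q)) = δ_t · q`**: the branch field of the datum `t` with coefficient `q` has branch coordinate `q` at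
`t` and `0` at every other datum. -/
theorem rho_sigma (B : Blocks ι n) (t : Branch B)
    (q : MvPolynomial (Fin n) K ⧸ Ideal.span {(X t.1.2.2 : MvPolynomial (Fin n) K), X t.1.2.1}) :
    rho B (sigma B t.2.1 t.2.2 q) = Pi.single t q := by
  classical
  obtain ⟨f, rfl⟩ := Ideal.Quotient.mk_surjective q
  rw [sigma_mk]
  funext t₀
  rw [rho_apply]
  by_cases ht : t₀ = t
  · subst ht
    rw [Pi.single_eq_same, rhoLoc_toBlock_branchField_self B t₀.2.1 t₀.2.2 f]
    dsimp only
    rw [Pi.single_eq_same]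
  · rw [Pi.single_eq_of_ne ht]
    obtain ⟨⟨i, a, b⟩, ha, hb⟩ := t
    obtain ⟨⟨i₀, a₀, b₀⟩, ha₀, hb₀⟩ := t₀
    dsimp only at ha hb ha₀ hb₀ ht ⊢
    by_cases hi : i₀ = i
    · subst hi
      by_cases haa : a₀ = a
      · subst haa
        have hbb : (⟨b₀, hb₀⟩ : ↥((B.S i₀).erase a₀)) ≠ ⟨b, hb⟩ := by
          intro h
          apply ht
          have : b₀ = b := congr_arg Subtype.val h
          subst this
          rfl
        rw [rhoLoc_toBlock_branchField_self B ha hb f]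
        dsimp only
        rw [Pi.single_eq_of_ne hbb, map_zero]
      · rw [rhoLoc_toBlock_branchField_eq_zero B ha hb f ⟨a₀, ha₀⟩ (dropDiv_gen_of_ne B ha hb haa), Pi.zero_apply]
    · rw [rhoLoc_toBlock_branchField_eq_zero B ha hb f ⟨a₀, ha₀⟩ (dropDiv_gen_other B ha hb hi), Pi.zero_apply]

/-- **`ρ ∘ τ = id`** — in particular `ρ` is onto: every branch function is the coordinate vector of a normal field. -/
theorem rho_tau (B : Blocks ι n) (v : BranchFunctions K B) : rho B (tau B v) = v := by
  rw [tau_apply, map_sum]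
  simp_rw [rho_sigma]
  exact Finset.univ_sum_single v

/-! ## `ρ` is injective -/

/-- **`ρ` is injective**: a normal field with all branch coordinates zero kills every test element in every
`R/I_{S_i}` (file XVII `apply_gen_eq_zero_of_rhoLoc_eq_zero`), hence vanishes in every `R/I_{S_i}`
(`eq_zero_of_apply_gen_eq_zero`), hence in `R/I_M = R/⋂_i I_{S_i}`. -/
theorem rho_injective (B : Blocks ι n) : Function.Injective (rho (K := K) B) := by
  rw [injective_iff_map_eq_zero]
  intro ψ hψ
  have hblock : ∀ i, toBlock B i ψ = 0 := by
    intro i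
    apply eq_zero_of_apply_gen_eq_zero
    intro a
    apply apply_gen_eq_zero_of_rhoLoc_eq_zero
    funext b
    have := congr_fun hψ ⟨(i, a.1, b.1), a.2, b.2⟩
    rw [rho_apply] at this
    exact this
  apply LinearMap.ext
  intro u
  apply eq_zero_of_forall_factor_eq_zero
  intro i
  have := LinearMap.congr_fun (hblock i) u
  rw [toBlock_apply] at this
  exact this

/-! ## The multi-block local lemma -/

variable (K) in
/-- **THE MULTI-BLOCK LOCAL LEMMA (EXT-NOTE §6.B(a), every block model `M(S_1, …, S_r)`, every `n`, every commutative
coefficient ring `K`).**  For pairwise disjoint non-empty blocks `S_i ⊂ [n]` and the arrangement ideal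
`I_M = ⋂_i (x_{S_i ∖ a} : a ∈ S_i)` of `M = ⋃_i K_{S_i} × 𝔸 ⊂ 𝔸ⁿ`:
`Hom_R(I_M, R/I_M) ≃ₗ[R] Π_{(i, a, b) : a ∈ S_i, b ∈ S_i ∖ a} R/(x_b, x_a)` — the normal module of the block model
is the product over the components `V(x_a, x_b) × 𝔸` (each counted twice) of their coordinate rings: «NO POLES»
(every normal field has polynomial branch coordinates) and «NO GLUING» (every tuple of branch functions is realised,
by the explicit fields `σ_{i,a,b}(f) : u ↦ f · (u|_{x_a=0} / x_b)`).  The forward map is `ρ` (branch coordinates),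
the inverse is `τ` (sum of branch fields). -/
noncomputable def blockNormalModuleEquiv (B : Blocks ι n) :
    (↥(arrIdeal K B) →ₗ[MvPolynomial (Fin n) K] MvPolynomial (Fin n) K ⧸ arrIdeal K B)
      ≃ₗ[MvPolynomial (Fin n) K] BranchFunctions K B :=
  LinearEquiv.ofBijective (rho B) ⟨rho_injective B, fun v => ⟨tau B v, rho_tau B v⟩⟩

/-- The equivalence is `ρ`. -/
theorem blockNormalModuleEquiv_apply (B : Blocks ι n)
    (ψ : ↥(arrIdeal K B) →ₗ[MvPolynomial (Fin n) K] MvPolynomial (Fin n) K ⧸ arrIdeal K B) :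
    blockNormalModuleEquiv K B ψ = rho B ψ := rfl

/-- Its inverse is `τ`: the normal field with prescribed branch coordinates is the sum of the branch fields. -/
theorem blockNormalModuleEquiv_symm_apply (B : Blocks ι n) (v : BranchFunctions K B) :
    (blockNormalModuleEquiv K B).symm v = tau B v := by
  apply (blockNormalModuleEquiv K B).injective
  rw [LinearEquiv.apply_symm_apply, blockNormalModuleEquiv_apply, rho_tau]

/-- **`τ ∘ ρ = id`: every `R`-linear `φ : I_M → R/I_M` is the sum of its branch fields** — «no gluing» in the form
«a normal field of `M` is nothing more than its restrictions to the branches». -/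
theorem tau_rho (B : Blocks ι n)
    (ψ : ↥(arrIdeal K B) →ₗ[MvPolynomial (Fin n) K] MvPolynomial (Fin n) K ⧸ arrIdeal K B) :
    tau B (rho B ψ) = ψ := by
  rw [← blockNormalModuleEquiv_apply, ← blockNormalModuleEquiv_symm_apply, LinearEquiv.symm_apply_apply]

/-- `τ` of a unit vector is the branch field: `τ(δ_t · q) = σ_t(q)`. -/
theorem tau_single (B : Blocks ι n) (t : Branch B)
    (q : MvPolynomial (Fin n) K ⧸ Ideal.span {(X t.1.2.2 : MvPolynomial (Fin n) K), X t.1.2.1}) :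
    tau B (Pi.single t q) = sigma B t.2.1 t.2.2 q := by
  classical
  rw [tau_apply, Finset.sum_eq_single t]
  · rw [Pi.single_eq_same]
  · intro t' _ ht'
    rw [Pi.single_eq_of_ne ht', map_zero]
  · intro h
    exact absurd (Finset.mem_univ t) h

/-- **The normal field with a single non-zero branch coordinate `q` at `t = (i, a, b)` is the branch field
`σ_{i,a,b}(q) : u ↦ q̃ · (u|_{x_a = 0} / x_b)`** (file XVIII). -/
theorem blockNormalModuleEquiv_symm_single (B : Blocks ι n) (t : Branch B)
    (q : MvPolynomial (Fin n) K ⧸ Ideal.span {(X t.1.2.2 : MvPolynomial (Fin n) K), X t.1.2.1}) :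
    (blockNormalModuleEquiv K B).symm (Pi.single t q) = sigma B t.2.1 t.2.2 q := by
  rw [blockNormalModuleEquiv_symm_apply, tau_single]

/-! ## Nested form `Π_i Π_{a ∈ S_i} Π_{b ∈ S_i ∖ a} R/(x_b, x_a)` -/

variable (K) in
/-- Branch functions in NESTED form: for each block `i`, each generator index `a ∈ S_i` and each partner `b ∈ S_i ∖ a`,
a class in `R/(x_b, x_a)` — the indexing of files VIII/IX (`(k, j) ↦ R/(x_j, x_k)`) block by block. -/
abbrev NestedBranchFunctions (B : Blocks ι n) : Type _ :=
  (i : ι) → (a : ↥(B.S i)) → (b : ↥((B.S i).erase a.1)) →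
    MvPolynomial (Fin n) K ⧸ Ideal.span {(X b.1 : MvPolynomial (Fin n) K), X a.1}

variable (K) in
/-- Re-indexing branch functions from triples to the nested form. -/
noncomputable def branchFunctionsCurry (B : Blocks ι n) : BranchFunctions K B ≃ₗ[MvPolynomial (Fin n) K]
    NestedBranchFunctions K B :=
  (LinearEquiv.piCongrLeft (MvPolynomial (Fin n) K)
      (fun t : Branch B => MvPolynomial (Fin n) K ⧸ Ideal.span {(X t.1.2.2 : MvPolynomial (Fin n) K), X t.1.2.1})
      (branchEquivSigma B).symm).symm
    ≪≫ₗ LinearEquiv.piCurry (MvPolynomial (Fin n) K)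
      (fun (i : ι) (s : Σ a : ↥(B.S i), ↥((B.S i).erase a.1)) =>
        MvPolynomial (Fin n) K ⧸ Ideal.span {(X s.2.1 : MvPolynomial (Fin n) K), X s.1.1})
    ≪≫ₗ LinearEquiv.piCongrRight fun i : ι => LinearEquiv.piCurry (MvPolynomial (Fin n) K)
      (fun (a : ↥(B.S i)) (b : ↥((B.S i).erase a.1)) =>
        MvPolynomial (Fin n) K ⧸ Ideal.span {(X b.1 : MvPolynomial (Fin n) K), X a.1})

variable (K) in
/-- **The multi-block local lemma in nested form**: `Hom_R(I_M, R/I_M) ≃ₗ[R] Π_i Π_{a ∈ S_i} Π_{b ∈ S_i ∖ a} R/(x_b, x_a)`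
(for one block `S = [n]` this is literally the shape of files VIII/IX's `normalModuleEquiv`). -/
noncomputable def blockNormalModuleEquivNested (B : Blocks ι n) :
    (↥(arrIdeal K B) →ₗ[MvPolynomial (Fin n) K] MvPolynomial (Fin n) K ⧸ arrIdeal K B)
      ≃ₗ[MvPolynomial (Fin n) K] NestedBranchFunctions K B :=
  blockNormalModuleEquiv K B ≪≫ₗ branchFunctionsCurry K B

/-- Its entries are the branch coordinates: entry `(i, a, b)` of the nested form is `ρ ψ (i, a, b)`. -/
theorem blockNormalModuleEquivNested_apply (B : Blocks ι n)
    (ψ : ↥(arrIdeal K B) →ₗ[MvPolynomial (Fin n) K] MvPolynomial (Fin n) K ⧸ arrIdeal K B)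
    (i : ι) (a : ↥(B.S i)) (b : ↥((B.S i).erase a.1)) :
    blockNormalModuleEquivNested K B ψ i a b = rho B ψ ⟨(i, a.1, b.1), a.2, b.2⟩ := rfl

/-! ## One block -/

/-- The block structure with a single block `S`. -/
def Blocks.single (S : Finset (Fin n)) (hS : S.Nonempty) : Blocks Unit n where
  S := fun _ => S
  disjoint := fun i j h => absurd (Subsingleton.elim i j) h
  nonempty := fun _ => hS

/-- For a single block the arrangement ideal is the block ideal `I_S` (so, by `blockIdeal_univ`, for `S = [n]` it is
file VIII's `I_W = srDesignIdeal K n`, and `blockNormalModuleEquiv` specialises to files VIII/IX's L1 (i)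
`normalModuleEquiv`, re-indexed and without the domain hypothesis on `K`). -/
theorem arrIdeal_single (S : Finset (Fin n)) (hS : S.Nonempty) :
    arrIdeal K (Blocks.single S hS) = blockIdeal K S := by
  show ⨅ _ : Unit, blockIdeal K S = blockIdeal K S
  exact iInf_const

end Summit.Ventures.HSemireg.ObstructionLocus.BlockModel
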